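import Summits.AtomisticToContinuum.BoseEinsteinCondensation.Theses.BECPalmDirectCorrelation

/-!
# Birth skeleton (BC3) for the crux `NonlinearPalmBound` (stmt-AtomisticToContinuum-12224)

Route `BECPalmDirectCorrelation` (rank-2 crux, wanted by this route only); registrar
`planner-skel-stmt-AtomisticToContinuum-12224-0`, 2026-08-17. Published as
`Cruxes/NonlinearPalmBound/Lines/birth.lean`.

**The crux (∃-witness / liminf form).** For every repulsive finite-range `v`, small `ρ`, some `C`,
eventually in `N = n + 1`, for EVERY slack `δ > 0` SOME `δ`-near-minimiser `Ψ` of the periodic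
`N`-body problem on the torus of side `L = (N/ρ)^{1/3}` has
`F(Ψ) ≤ 1 + G(Ψ) + C`, `F = periodicMeanSelfDensity n L Ψ` (the Palm χ² functional
`E_P[(dQ_x/dP)²]`), `G = Σ_{m≠0} (S_m − 1)²/((n−1)S_m + 1)` (first chaos = `‖Y₁‖²_{L²(P)}`).

**The line: SCALE DECOMPOSITION OF THE PALM DENSITY (momentum shells of the tagged particle).**
Plancherel in the tagged coordinate `x` at fixed bath `Y` turns `F` into a MODE SUM

  `F(Ψ) = Σ_{m ∈ ℤ³} A_m(Ψ)`,  `A_m(Ψ) = L⁶ ∫_{cell^n} |ĉ_m(|Ψ(·,Y)|²)|² / D(Y) dY = E_P |E[e_m(x) | Y]|²`,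

`D(Y) = ∫_cell |Ψ(x,Y)|² dx` the bath marginal, `ĉ_m` the cell Fourier coefficient
(`cellFourierCoeff`): `A_m` is the bath's mean-square power to predict the tagged particle's
position at wave-vector `k = 2πm/L` (squared `L²(P)`-norm of the conditional characteristic
function), and `A_0 = 1` (normalisation). For the translation-invariant ground state the Gaussian
part splits the same way, `G = Σ_{m≠0} G_m` with `G_m = |⟨a_m, ρ_m⟩_P|²/‖ρ_m‖²_P ≤ A_m`
(Campbell–Mecke; the refuter's exact finite check of 2026-08-15), so `F − 1 − G = Σ_{m≠0}(A_m − G_m)`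
is a sum of NON-NEGATIVE per-mode nonlinear responses, and the crux is cut BY SCALE:

* `stub_palmPlancherel` (identity, provable now, M in Lean): `F(Ψ) = 1 + Σ_{m≠0} A_m(Ψ)` for every
  periodic trial state — Parseval on the cell (`tsum_sq_cellFourierCoeff`) at fixed `Y`, Tonelli,
  and `A_0 = ∫ D = ‖Ψ‖² = 1`.
* `stub_uvRegularity` (ULTRAVIOLET, ∃-form, M/L): for some window `K = K(v,ρ) > 0` and every slack,
  some near-minimiser has `Σ_{|m|/L > K} A_m ≤ C₂` uniformly in `N` — short-distance REGULARITY of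
  the conditional density of the tagged particle given the bath (gradient Parseval:
  `Σ_{|k|>2πK} A_k ≤ (2πK)⁻² Σ_k |k|² A_k = (2πK)⁻² L³ ∫dY ∫dx |∇_x|Ψ|²|²/D`, an intensive
  Fisher-type functional, `≈ 4ρa/(2πK)²` for a Jastrow-like ground state; elliptic/Harnack input,
  hard cores included since the zero-energy scattering solution is Lipschitz). The known `C¹`-spike
  that killed every sup-form `F`-statement lives entirely in these UV modes, hence the ∃-form.
* `stub_irResponse` (INFRARED, sup-form over `δ₀(N)`-near-minimisers like `GaussianPalmBound`, the
  HARDEST stub, open): for EVERY window `K > 0` there is `C₁(v,ρ,K)` with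
  `Σ_{0<|m|/L ≤ K} A_m ≤ G + C₁` — the NONLINEAR static response of the bath to the test particle is
  square-summable over the `~ N K³/ρ` modes of a bounded momentum window (each mode `O(1/N)`; the
  `k, k' → 0` behaviour of the quadratic response against `1/(S(k)S(k'))` is the named risk of the
  crux). Sup form is legitimate here: at fixed `N` the window sum is a FINITE sum of functionals
  `A_m`, each `L²`-continuous (generalised dominated convergence, `|ĉ_m|²/ĉ_0 ≤ ĉ_0`), and `G` is
  lower semicontinuous (Fatou over modes, each `G_m` continuous), so the spike cannot touch it and
  the statement reduces to the ground eigensphere by compactness at fixed `(N, L)`.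

`NonlinearPalmBound_of : Sig.stub_palmPlancherel → Sig.stub_uvRegularity → Sig.stub_irResponse →
NonlinearPalmBound` is sorry-free: `ρ₀ = min`, take `K, C₂` from the UV stub, feed `K` to the IR
stub, `C = max C₁ 0 + max C₂ 0`, intersect the eventual-`n` sets, and for a slack `δ` take the UV
witness at slack `min δ δ₀` (it is a `δ`- and a `δ₀`-near-minimiser); then
`F = 1 + Σ_{m≠0} A_m ≤ 1 + (IR + UV) ≤ 1 + G + C₁ + C₂` (`palmModes_le_ir_add_uv`, pointwise split
of the mode sum, `ENNReal.tsum_add`).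

**Disproof used.** No `Disproof.lean` / `Negative/` lemma exists for this crux (crux dir empty at
registration); the only negative of the summit (`BECSwapAffinity.SwapJensen`, an `N = 1` sign
witness) is unrelated; no stub quantifies a real constant universally and `∀ᶠ n` excludes small `N`.
The retired sup-form items of `BECPercusPalm` (C¹-spike) are honoured: the only sup-form stub is the
spike-blind IR window sum.

**Alternative cut recorded, not filed.** The route's foreseen chaos-order split
(`SecondChaosBound` `‖Y₂‖²` → `HigherChaosTail` `Σ_{n≥3}`) needs the degree-2 orthogonal projection in
`L²(P)`; it is the natural SECOND cut of `stub_irResponse`, not of the crux.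

**BC3 audit (2026-08-17, farm).** `lean check --json` on this file: rc 0, errors [], sorries 3 =
the three `stub_*` (nothing else sorried; `NonlinearPalmBound_of`, `palmModes_le_ir_add_uv`,
`birth_arith`, `nonlinearPalmBound_iff` are closed). Probes (folder `bc/probe_*.lean`, importing only
the sub-problem `Statement` + the Literature modules of the crux signature, crux restated verbatim):
for each stub `S ∈ {palmPlancherel, uvRegularity, irResponse}` both
`example : Sig.S → NonlinearPalmBound` and `example : Sig.S → BoseEinsteinCondensation` by
`first | exact? | simpa [..] | (unfold ..; simpa) | aesop` FAIL (rc 1: "unsolved goals" after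
"aesop: failed to prove the goal after exhaustive search"; split runs: `exact?` "could not close the
goal" / whnf-timeout at 400000 heartbeats, `aesop` exhaustive-search failure, `simpa` type mismatch)
— no stub is cheaply the crux or the summit.
-/

noncomputable section

namespace Summit.AtomisticToContinuum.BoseEinsteinCondensation.Cruxes.NonlinearPalmBound.Birth

open MeasureTheory Filter
open scoped ENNReal NNReal BigOperators
open Literature.MathematicalPhysics.QuantumManyBody.BoseGas
open Summit.AtomisticToContinuum.BoseEinsteinCondensation.Theses.BECPalmDirectCorrelation
  (NonlinearPalmBound)

/-! ## §1 Vocabulary (all over existing declarations) -/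

/-- The (uncentred, cell-restricted) structure factor `S_m(Ψ) = N⁻¹ ∫_{cell^N} |Σ_j e_m(x_j)|² |Ψ|²`
— verbatim the crux's let-bound `S`. -/
def structureFactor (n : ℕ) (L : ℝ) (Ψ : Config (n + 1) → ℂ) (m : Fin 3 → ℤ) : ℝ≥0∞ :=
  ((n + 1 : ℕ) : ℝ≥0∞)⁻¹ *
    (∫⁻ X in cellN (n + 1) L,
      (‖∑ j : Fin (n + 1), cellWave L m (X j)‖₊ : ℝ≥0∞) ^ 2 * (‖Ψ X‖₊ : ℝ≥0∞) ^ 2)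

/-- The Gaussian (first-chaos) part `G(Ψ) = Σ_{m≠0} (S_m − 1)²/((n−1)S_m + 1)` — verbatim the
crux's let-bound `G`. -/
def gaussianPart (n : ℕ) (L : ℝ) (Ψ : Config (n + 1) → ℂ) : ℝ≥0∞ :=
  ∑' m : Fin 3 → ℤ, (if m = 0 then (0 : ℝ≥0∞) else
    ENNReal.ofReal (((structureFactor n L Ψ m).toReal - 1) ^ 2 /
      (((n - 1 : ℕ) : ℝ) * (structureFactor n L Ψ m).toReal + 1)))

/-- The **Palm mode energy** `A_m(Ψ) = L⁶ ∫_{cell^n} |ĉ_m(|Ψ(·,Y)|²)|² / D(Y) dY`,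
`D(Y) = ∫_cell |Ψ(x,Y)|² dx`: the squared `L²(P)`-norm of the conditional characteristic function
`Y ↦ E[e_m(x) | Y]` of the tagged particle (`x` = particle `0`, `Matrix.vecCons`, as in
`meanSelfDensity`). `Σ_m A_m = F`, `A_0 = 1` (`stub_palmPlancherel`). -/
def palmMode (n : ℕ) (L : ℝ) (Ψ : Config (n + 1) → ℂ) (m : Fin 3 → ℤ) : ℝ≥0∞ :=
  ENNReal.ofReal (L ^ 6) * ∫⁻ Y in cellN n L,
    (‖cellFourierCoeff L (fun x => ((‖Ψ (Matrix.vecCons x Y)‖ ^ 2 : ℝ) : ℂ)) m‖₊ : ℝ≥0∞) ^ 2 /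
      ∫⁻ x in cell L, (‖Ψ (Matrix.vecCons x Y)‖₊ : ℝ≥0∞) ^ 2

/-- Infrared window sum `Σ_{m ≠ 0, |m|/L ≤ K} A_m(Ψ)` (`|k| = 2π|m|/L ≤ 2πK`). -/
def irPalmSum (n : ℕ) (L K : ℝ) (Ψ : Config (n + 1) → ℂ) : ℝ≥0∞ :=
  ∑' m : Fin 3 → ℤ, (if m ≠ 0 ∧ ‖latticeVec L⁻¹ m‖ ≤ K then palmMode n L Ψ m else 0)

/-- Ultraviolet tail sum `Σ_{|m|/L > K} A_m(Ψ)`. -/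
def uvPalmSum (n : ℕ) (L K : ℝ) (Ψ : Config (n + 1) → ℂ) : ℝ≥0∞ :=
  ∑' m : Fin 3 → ℤ, (if K < ‖latticeVec L⁻¹ m‖ then palmMode n L Ψ m else 0)

/-- The crux, restated over the vocabulary (definitional: `let`s zeta-reduce, `gaussianPart` and
`structureFactor` delta-reduce to the crux's inlined `S`, `G`). -/
theorem nonlinearPalmBound_iff :
    NonlinearPalmBound ↔
      ∀ v : ℝ → ℝ≥0∞, IsRepulsiveFiniteRange v → ∃ ρ₀ : ℝ, 0 < ρ₀ ∧ ∀ ρ : ℝ, 0 < ρ → ρ < ρ₀ →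
        ∃ C : ℝ, ∀ᶠ n : ℕ in atTop, ∀ δ : ℝ≥0∞, 0 < δ →
          ∃ Ψ : PeriodicTrialState (n + 1) (sideLength ρ (n + 1)),
            periodicEnergy v Ψ ≤ periodicGroundStateEnergy v (n + 1) (sideLength ρ (n + 1)) + δ ∧
              periodicMeanSelfDensity n (sideLength ρ (n + 1)) Ψ.ψ ≤
                1 + gaussianPart n (sideLength ρ (n + 1)) Ψ.ψ + ENNReal.ofReal C :=
  Iff.rfl

/-! ## §2 Stub signatures (named, so that `NonlinearPalmBound_of` takes them by name) -/

/-- Signature of `stub_palmPlancherel`. -/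
def Sig.stub_palmPlancherel : Prop :=
  ∀ (n : ℕ) (L : ℝ) (Ψ : PeriodicTrialState (n + 1) L),
    periodicMeanSelfDensity n L Ψ.ψ =
      1 + ∑' m : Fin 3 → ℤ, (if m = 0 then (0 : ℝ≥0∞) else palmMode n L Ψ.ψ m)

/-- Signature of `stub_uvRegularity`. -/
def Sig.stub_uvRegularity : Prop :=
  ∀ v : ℝ → ℝ≥0∞, IsRepulsiveFiniteRange v → ∃ ρ₀ : ℝ, 0 < ρ₀ ∧ ∀ ρ : ℝ, 0 < ρ → ρ < ρ₀ →
    ∃ K : ℝ, 0 < K ∧ ∃ C : ℝ, ∀ᶠ n : ℕ in atTop, ∀ δ : ℝ≥0∞, 0 < δ →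
      ∃ Ψ : PeriodicTrialState (n + 1) (sideLength ρ (n + 1)),
        periodicEnergy v Ψ ≤ periodicGroundStateEnergy v (n + 1) (sideLength ρ (n + 1)) + δ ∧
          uvPalmSum n (sideLength ρ (n + 1)) K Ψ.ψ ≤ ENNReal.ofReal C

/-- Signature of `stub_irResponse`. -/
def Sig.stub_irResponse : Prop :=
  ∀ v : ℝ → ℝ≥0∞, IsRepulsiveFiniteRange v → ∃ ρ₀ : ℝ, 0 < ρ₀ ∧ ∀ ρ : ℝ, 0 < ρ → ρ < ρ₀ →
    ∀ K : ℝ, 0 < K → ∃ C : ℝ, ∀ᶠ n : ℕ in atTop, ∃ δ : ℝ≥0∞, 0 < δ ∧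
      ∀ Ψ : PeriodicTrialState (n + 1) (sideLength ρ (n + 1)),
        periodicEnergy v Ψ ≤ periodicGroundStateEnergy v (n + 1) (sideLength ρ (n + 1)) + δ →
          irPalmSum n (sideLength ρ (n + 1)) K Ψ.ψ ≤
            gaussianPart n (sideLength ρ (n + 1)) Ψ.ψ + ENNReal.ofReal C

/-! ## §3 The registered stubs (`sorry` lives only here) -/

/-- **Stub 1 — Palm–Plancherel identity** (provable now; Parseval on the cell at fixed bath
configuration, Tonelli, normalisation): `F(Ψ) = 1 + Σ_{m≠0} A_m(Ψ)` for every periodic trial state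
(`L ≤ 0` is vacuous: there are no trial states). -/
theorem stub_palmPlancherel : ∀ (n : ℕ) (L : ℝ) (Ψ : PeriodicTrialState (n + 1) L),
    periodicMeanSelfDensity n L Ψ.ψ =
      1 + ∑' m : Fin 3 → ℤ, (if m = 0 then (0 : ℝ≥0∞) else palmMode n L Ψ.ψ m) := by
  sorry

/-- **Stub 2 — ultraviolet regularity of the Palm density** (∃-form; M/L): for every repulsive
finite-range `v` and small `ρ` there are a window `K > 0` and `C` such that, eventually in `N`, for
every slack some near-minimiser has UV Palm tail `Σ_{|m|/L > K} A_m ≤ C` (short-distance regularity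
of the conditional density of the tagged particle given the bath; gradient Parseval + elliptic
bounds at scale `a`; the spike-robustness failure of `F` is confined here, hence ∃-form). -/
theorem stub_uvRegularity : ∀ v : ℝ → ℝ≥0∞, IsRepulsiveFiniteRange v → ∃ ρ₀ : ℝ, 0 < ρ₀ ∧
    ∀ ρ : ℝ, 0 < ρ → ρ < ρ₀ → ∃ K : ℝ, 0 < K ∧ ∃ C : ℝ, ∀ᶠ n : ℕ in atTop, ∀ δ : ℝ≥0∞, 0 < δ →
      ∃ Ψ : PeriodicTrialState (n + 1) (sideLength ρ (n + 1)),
        periodicEnergy v Ψ ≤ periodicGroundStateEnergy v (n + 1) (sideLength ρ (n + 1)) + δ ∧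
          uvPalmSum n (sideLength ρ (n + 1)) K Ψ.ψ ≤ ENNReal.ofReal C := by
  sorry

/-- **Stub 3 — infrared nonlinear response** (sup form over `δ₀(N)`-near-minimisers; the HARDEST
stub, open): for every repulsive finite-range `v`, small `ρ` and EVERY window `K > 0` there is `C`
such that, eventually in `N`, for some slack `δ₀ > 0` every `δ₀`-near-minimiser has
`Σ_{0 < |m|/L ≤ K} A_m ≤ G + C` — the nonlinear static response of the bath to the test particle is
square-summable over a bounded momentum window, uniformly in `N`. -/
theorem stub_irResponse : ∀ v : ℝ → ℝ≥0∞, IsRepulsiveFiniteRange v → ∃ ρ₀ : ℝ, 0 < ρ₀ ∧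
    ∀ ρ : ℝ, 0 < ρ → ρ < ρ₀ → ∀ K : ℝ, 0 < K → ∃ C : ℝ, ∀ᶠ n : ℕ in atTop, ∃ δ : ℝ≥0∞, 0 < δ ∧
      ∀ Ψ : PeriodicTrialState (n + 1) (sideLength ρ (n + 1)),
        periodicEnergy v Ψ ≤ periodicGroundStateEnergy v (n + 1) (sideLength ρ (n + 1)) + δ →
          irPalmSum n (sideLength ρ (n + 1)) K Ψ.ψ ≤
            gaussianPart n (sideLength ρ (n + 1)) Ψ.ψ + ENNReal.ofReal C := by
  sorry

/-! ## §4 Composition (sorry-free): the three stubs give the crux BY NAME -/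

/-- Pointwise split of the mode sum into the window and the tail (no hypothesis on `K`). -/
theorem palmModes_le_ir_add_uv (n : ℕ) (L K : ℝ) (Ψ : Config (n + 1) → ℂ) :
    (∑' m : Fin 3 → ℤ, (if m = 0 then (0 : ℝ≥0∞) else palmMode n L Ψ m)) ≤
      irPalmSum n L K Ψ + uvPalmSum n L K Ψ := by
  rw [irPalmSum, uvPalmSum, ← ENNReal.tsum_add]
  refine ENNReal.tsum_le_tsum fun m => ?_
  by_cases hm : m = 0
  · simp [hm]
  · by_cases hk : ‖latticeVec L⁻¹ m‖ ≤ K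
    · simp [hm, hk, not_lt.2 hk]
    · simp [hm, hk, not_le.1 hk]

/-- The only arithmetic of the composition, in `ℝ≥0∞`. -/
theorem birth_arith {F P I U G : ℝ≥0∞} {C₁ C₂ : ℝ} (hF : F = 1 + P) (hP : P ≤ I + U)
    (hI : I ≤ G + ENNReal.ofReal C₁) (hU : U ≤ ENNReal.ofReal C₂) :
    F ≤ 1 + G + ENNReal.ofReal (max C₁ 0 + max C₂ 0) := by
  have h0₁ : (0 : ℝ) ≤ max C₁ 0 := le_max_right _ _
  have h0₂ : (0 : ℝ) ≤ max C₂ 0 := le_max_right _ _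
  have hC₁ : ENNReal.ofReal C₁ ≤ ENNReal.ofReal (max C₁ 0) := ENNReal.ofReal_le_ofReal (le_max_left _ _)
  have hC₂ : ENNReal.ofReal C₂ ≤ ENNReal.ofReal (max C₂ 0) := ENNReal.ofReal_le_ofReal (le_max_left _ _)
  rw [ENNReal.ofReal_add h0₁ h0₂, hF]
  calc 1 + P ≤ 1 + (I + U) := add_le_add le_rfl hP
    _ ≤ 1 + ((G + ENNReal.ofReal (max C₁ 0)) + ENNReal.ofReal (max C₂ 0)) :=
        add_le_add le_rfl (add_le_add (hI.trans (add_le_add le_rfl hC₁)) (hU.trans hC₂))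
    _ = 1 + G + (ENNReal.ofReal (max C₁ 0) + ENNReal.ofReal (max C₂ 0)) := by
        simp only [add_assoc]

/-- **Composition.** The Palm–Plancherel identity, the ultraviolet regularity of some near-minimiser
at every slack, and the infrared nonlinear-response bound on all near-minimisers give the crux
`NonlinearPalmBound` BY NAME: `ρ₀ = min ρ₁ ρ₂`, `K, C₂` from the UV stub, `C₁ = C₁(K)` from the IR
stub, `C = max C₁ 0 + max C₂ 0`, witness = the UV witness at slack `min δ δ₀`. -/
theorem NonlinearPalmBound_of :
    Sig.stub_palmPlancherel → Sig.stub_uvRegularity → Sig.stub_irResponse →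
      Summit.AtomisticToContinuum.BoseEinsteinCondensation.Theses.BECPalmDirectCorrelation.NonlinearPalmBound := by
  intro hP hUV hIR
  refine nonlinearPalmBound_iff.2 fun v hv => ?_
  obtain ⟨ρ₁, hρ₁, h₁⟩ := hUV v hv
  obtain ⟨ρ₂, hρ₂, h₂⟩ := hIR v hv
  refine ⟨min ρ₁ ρ₂, lt_min hρ₁ hρ₂, fun ρ hρ hρlt => ?_⟩
  obtain ⟨K, hK, C₂, hC₂⟩ := h₁ ρ hρ (lt_of_lt_of_le hρlt (min_le_left _ _))
  obtain ⟨C₁, hC₁⟩ := h₂ ρ hρ (lt_of_lt_of_le hρlt (min_le_right _ _)) K hK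
  refine ⟨max C₁ 0 + max C₂ 0, ?_⟩
  filter_upwards [hC₁, hC₂] with n hn₁ hn₂
  intro δ hδ
  obtain ⟨δ₀, hδ₀, hall⟩ := hn₁
  obtain ⟨Ψ, hΨE, hΨUV⟩ := hn₂ (min δ δ₀) (lt_min hδ hδ₀)
  refine ⟨Ψ, hΨE.trans (add_le_add le_rfl (min_le_left _ _)), ?_⟩
  exact birth_arith (hP n _ Ψ) (palmModes_le_ir_add_uv n _ K Ψ.ψ)
    (hall Ψ (hΨE.trans (add_le_add le_rfl (min_le_right _ _)))) hΨUV

/-- The composition applied to the (sorried) stubs: the registered stub statements ARE the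
`Sig.*` hypotheses of `NonlinearPalmBound_of` (definitional check). -/
example : Summit.AtomisticToContinuum.BoseEinsteinCondensation.Theses.BECPalmDirectCorrelation.NonlinearPalmBound :=
  NonlinearPalmBound_of stub_palmPlancherel stub_uvRegularity stub_irResponse

end Summit.AtomisticToContinuum.BoseEinsteinCondensation.Cruxes.NonlinearPalmBound.Birth

end
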